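import Literature.AnabelianGeometry.SemiGraphs.PSCThreeChainRows
import Literature.AnabelianGeometry.SemiGraphs.PSCTwoComponentAffineGraphicOrigin
import HarnessLib

/-!
# [CombGC] Prop. 1.2, Prop. 1.5, Thm. 1.6 (i) HOLD at the origin of genuine THREE-COMPONENT CHAIN data

Mochizuki, *A combinatorial version of the Grothendieck conjecture* [CombGC] §1: Prop. 1.2 (i)(ii) p. 8,
Prop. 1.5 (i)(ii) pp. 12–13, Thm. 1.6 (i) p. 13; *Inter-universal Teichmüller theory I* Rmk. 1.2.3 (iv)
(cuspidal edge-like subgroups) [cite: MochizukiCombGC2007, Prop 1.5(ii) p.13]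
[cite: MochizukiCombGC2007, Thm 1.6(i) p.13] [cite: Mochizuki2012, IUTchI Rmk 1.2.3(iv) pp.41-42].
PROOF-ONLY assembly file (abc-iut-f-164 gen 3; abc-iut FACT-LIST rows F-0459, F-0438, F-0440, F-0443,
F-1931, F-0458, and — vacuously — F-0461; schemata over the origin parameter `Ω : PSCOrigin`, universal
closures refuted, instance forms the content).  The data of THREE-COMPONENT CHAIN SHAPE
(`PSCThreeChainShape.lean` / `PSCThreeChainRows.lean`): a chain `C₀ ∪_{ν_A} C_mid ∪_{ν_B} C₁` of three
pointed components, TWO nodes — the first genuine carrier with more than one node.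

* `exists_threeChainDatum` — such data EXIST over a pro-`Σ` completion of every `Γ_{g,r}`, for all
  splittings `g₀ ≤ g₁` of the handles and `s₁ ≤ s₂` of the cusps (semi-graph `V = Fin 3`, `N = Bool`,
  `nodeEnds A = s(0,1)`, `nodeEnds B = s(1,2)`);
* `threeChainOrigin_rows` — at every origin of three-component chain data: **F-0440** (Prop. 1.5 (i): each
  node lies in exactly two of the THREE verticial subgroups), the verticial and edge-like clauses of F-0459 and
  the first clause of F-0438 datum-wise, **F-1931** (cuspidally standard), and — when every datum has a
  component of genus `< 2`, so that the sturdy `Π^unr`-clauses are vacuous — **F-0459**, **F-0438**, **F-0443**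
  (Prop. 1.5 (ii), abc-iut-w4-d081's reduction), **F-0458** for `Σ = {l}` (Thm. 1.6 (i), abc-iut-f-164's
  reduction `numericallyCuspidalIffHolds_of_characterization`), F-0461 vacuously;
* `exists_threeChainOrigin_holds` — for a prime `l`, the origin of three-component chain data with `Σ = {l}`
  and a rational first component (`g₀ = 0`; inhabited for every `g₁ ≤ g`, `2 ≤ s₁`, `s₁ + 2 ≤ s₂`,
  `s₂ + 2 ≤ r`) satisfies ALL of F-0438 ∧ F-0459 ∧ F-0440 ∧ F-0443 ∧ F-1931 ∧ F-0458 (∧ F-0461 vacuously).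

HONEST SCOPE: the sturdy `Π^unr`-clauses at chain data all of whose components have genus `≥ 2` are NOT
treated.  Instance forms at data of the shape of genuine three-component curves: consistency evidence for the
typed schemata, not the printed theorems for all pointed stable curves (FOUNDATIONS rows 13–14).  0
definitions; nothing here takes a side on [IUTchIII] Cor. 3.12.
-/

noncomputable section

namespace Literature.AnabelianGeometry.SemiGraphs

open scoped Pointwise
open Literature.GroupTheory.CombinatorialGroupTheory
open SemiGraphOfAnabelioids (IsProSigmaCompletion)

universe u

namespace PSCDatum

/-! ### Data of three-component chain shape exist -/

/-- **Data of three-component chain shape exist** over a pro-`Σ` completion `ι : Γ_{g,r} → Π` (every `Σ`,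
every splitting `g₀, g₁`, `s₁, s₂`): semi-graph `V = Fin 3` (`0 = C₀`, `1 = C_mid`, `2 = C₁`), `N = Bool`
(`false = ν_A` joining `0,1`; `true = ν_B` joining `1,2`), cusps `Fin r`; the branch inclusions of Def. 1.1
hold with trivial conjugators. [cite: MochizukiCombGC2007, Def 1.1 pp.6-7] -/
theorem exists_threeChainDatum (Sigma : Set ℕ) (hne : Sigma.Nonempty)
    (hprime : ∀ p ∈ Sigma, p.Prime) (g r g₀ g₁ s₁ s₂ : ℕ) :
    ∃ (Q : ProfiniteGrp.{0}) (ι : PuncturedSurfaceGroup g r →* Q) (G : PSCDatum Q)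
      (e : G.graph.C ≃ Fin r) (v₀ vm v₁ : G.graph.V) (nA nB : G.graph.N) (εA η : PuncturedSurfaceGroup g r),
      IsProSigmaCompletion Sigma ι ∧ G.Sigma = Sigma ∧ G.graph.i = 3 ∧ G.graph.n = 2 ∧ G.graph.r = r ∧
      (∀ c, G.cuspGp c =
        ((PuncturedSurfaceGroup.cuspInertia (g := g) (e c)).map ι).topologicalClosure) ∧
      (∀ w, w = v₀ ∨ w = vm ∨ w = v₁) ∧ (∀ n, n = nA ∨ n = nB) ∧
      εA = ((List.finRange r).map fun j : Fin r =>
            if s₂ ≤ (j : ℕ) then PuncturedSurfaceGroup.c (g := g) j else 1).prod *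
          ((List.finRange g).map fun i : Fin g => if (i : ℕ) < g₀ then
            PuncturedSurfaceGroup.a (r := r) i * PuncturedSurfaceGroup.b i *
              (PuncturedSurfaceGroup.a i)⁻¹ * (PuncturedSurfaceGroup.b i)⁻¹ else 1).prod ∧
      η = ((List.finRange r).map fun j : Fin r =>
            if s₁ ≤ (j : ℕ) then PuncturedSurfaceGroup.c (g := g) j else 1).prod *
          ((List.finRange g).map fun i : Fin g => if (i : ℕ) < g₁ then
            PuncturedSurfaceGroup.a (r := r) i * PuncturedSurfaceGroup.b i *
              (PuncturedSurfaceGroup.a i)⁻¹ * (PuncturedSurfaceGroup.b i)⁻¹ else 1).prod ∧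
      G.vertGp v₀ = ((Subgroup.closure {x : PuncturedSurfaceGroup g r |
          (∃ i : Fin g, (i : ℕ) < g₀ ∧ (x = PuncturedSurfaceGroup.a i ∨ x = PuncturedSurfaceGroup.b i)) ∨
          ∃ j : Fin r, s₂ ≤ (j : ℕ) ∧ x = PuncturedSurfaceGroup.c j}).map ι).topologicalClosure ∧
      G.vertGp vm = ((Subgroup.closure {x : PuncturedSurfaceGroup g r |
          (∃ i : Fin g, (g₀ ≤ (i : ℕ) ∧ (i : ℕ) < g₁) ∧
            (x = PuncturedSurfaceGroup.a i ∨ x = PuncturedSurfaceGroup.b i)) ∨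
          (∃ j : Fin r, (s₁ ≤ (j : ℕ) ∧ (j : ℕ) < s₂) ∧ x = PuncturedSurfaceGroup.c j) ∨
          x = εA ∨ x = η}).map ι).topologicalClosure ∧
      G.vertGp v₁ = ((Subgroup.closure {x : PuncturedSurfaceGroup g r |
          (∃ i : Fin g, g₁ ≤ (i : ℕ) ∧ (x = PuncturedSurfaceGroup.a i ∨ x = PuncturedSurfaceGroup.b i)) ∨
          (∃ j : Fin r, (j : ℕ) < s₁ ∧ x = PuncturedSurfaceGroup.c j) ∨ x = η}).map ι).topologicalClosure ∧
      G.nodeGp nA = ((Subgroup.zpowers εA).map ι).topologicalClosure ∧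
      G.nodeGp nB = ((Subgroup.zpowers η).map ι).topologicalClosure ∧
      G.genus v₀ = g₀ ∧ G.genus vm = g₁ - g₀ ∧ G.genus v₁ = g - g₁ ∧
      G.graph.nodeEnds nA = s(v₀, vm) ∧ G.graph.nodeEnds nB = s(vm, v₁) := by
  classical
  obtain ⟨Q, ι, hι⟩ :=
    IsProSigmaCompletion.exists_isProSigmaCompletion (PuncturedSurfaceGroup g r) Sigma
  let εA : PuncturedSurfaceGroup g r := ((List.finRange r).map fun j : Fin r =>
            if s₂ ≤ (j : ℕ) then PuncturedSurfaceGroup.c (g := g) j else 1).prod *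
          ((List.finRange g).map fun i : Fin g => if (i : ℕ) < g₀ then
            PuncturedSurfaceGroup.a (r := r) i * PuncturedSurfaceGroup.b i *
              (PuncturedSurfaceGroup.a i)⁻¹ * (PuncturedSurfaceGroup.b i)⁻¹ else 1).prod
  let η : PuncturedSurfaceGroup g r := ((List.finRange r).map fun j : Fin r =>
            if s₁ ≤ (j : ℕ) then PuncturedSurfaceGroup.c (g := g) j else 1).prod *
          ((List.finRange g).map fun i : Fin g => if (i : ℕ) < g₁ then
            PuncturedSurfaceGroup.a (r := r) i * PuncturedSurfaceGroup.b i *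
              (PuncturedSurfaceGroup.a i)⁻¹ * (PuncturedSurfaceGroup.b i)⁻¹ else 1).prod
  let T₀ : Set (PuncturedSurfaceGroup g r) := {x |
    (∃ i : Fin g, (i : ℕ) < g₀ ∧ (x = PuncturedSurfaceGroup.a i ∨ x = PuncturedSurfaceGroup.b i)) ∨
    ∃ j : Fin r, s₂ ≤ (j : ℕ) ∧ x = PuncturedSurfaceGroup.c j}
  let Tm : Set (PuncturedSurfaceGroup g r) := {x |
    (∃ i : Fin g, (g₀ ≤ (i : ℕ) ∧ (i : ℕ) < g₁) ∧
      (x = PuncturedSurfaceGroup.a i ∨ x = PuncturedSurfaceGroup.b i)) ∨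
    (∃ j : Fin r, (s₁ ≤ (j : ℕ) ∧ (j : ℕ) < s₂) ∧ x = PuncturedSurfaceGroup.c j) ∨ x = εA ∨ x = η}
  let T₁ : Set (PuncturedSurfaceGroup g r) := {x |
    (∃ i : Fin g, g₁ ≤ (i : ℕ) ∧ (x = PuncturedSurfaceGroup.a i ∨ x = PuncturedSurfaceGroup.b i)) ∨
    (∃ j : Fin r, (j : ℕ) < s₁ ∧ x = PuncturedSurfaceGroup.c j) ∨ x = η}
  let A₀ : Subgroup Q := ((Subgroup.closure T₀).map ι).topologicalClosure
  let Am : Subgroup Q := ((Subgroup.closure Tm).map ι).topologicalClosure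
  let A₁ : Subgroup Q := ((Subgroup.closure T₁).map ι).topologicalClosure
  let NA : Subgroup Q := ((Subgroup.zpowers εA).map ι).topologicalClosure
  let NB : Subgroup Q := ((Subgroup.zpowers η).map ι).topologicalClosure
  -- the loop `ε_A` is a word in the generators of `C₀`
  have hεA₀ : εA ∈ Subgroup.closure T₀ := by
    refine Subgroup.mul_mem _ (Subgroup.list_prod_mem _ fun x hx => ?_)
      (Subgroup.list_prod_mem _ fun x hx => ?_)
    · obtain ⟨j, -, rfl⟩ := List.mem_map.mp hx
      split_ifs with h
      · exact Subgroup.subset_closure (Or.inr ⟨j, h, rfl⟩)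
      · exact Subgroup.one_mem _
    · obtain ⟨i, -, rfl⟩ := List.mem_map.mp hx
      split_ifs with h
      · have ha : PuncturedSurfaceGroup.a (r := r) i ∈ Subgroup.closure T₀ :=
          Subgroup.subset_closure (Or.inl ⟨i, h, Or.inl rfl⟩)
        have hb : PuncturedSurfaceGroup.b (r := r) i ∈ Subgroup.closure T₀ :=
          Subgroup.subset_closure (Or.inl ⟨i, h, Or.inr rfl⟩)
        exact Subgroup.mul_mem _ (Subgroup.mul_mem _ (Subgroup.mul_mem _ ha hb)
          (Subgroup.inv_mem _ ha)) (Subgroup.inv_mem _ hb)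
      · exact Subgroup.one_mem _
  have hle : ∀ (x : PuncturedSurfaceGroup g r) (T : Set (PuncturedSurfaceGroup g r)),
      x ∈ Subgroup.closure T →
        ((Subgroup.zpowers x).map ι).topologicalClosure ≤ ((Subgroup.closure T).map ι).topologicalClosure :=
    fun x T hx => Subgroup.topologicalClosure_mono (Subgroup.map_mono ((Subgroup.zpowers_le).mpr hx))
  have hNA₀ : NA ≤ A₀ := hle εA T₀ hεA₀
  have hNAm : NA ≤ Am := hle εA Tm (Subgroup.subset_closure (Or.inr (Or.inr (Or.inl rfl))))
  have hNBm : NB ≤ Am := hle η Tm (Subgroup.subset_closure (Or.inr (Or.inr (Or.inr rfl))))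
  have hNB₁ : NB ≤ A₁ := hle η T₁ (Subgroup.subset_closure (Or.inr (Or.inr rfl)))
  let vG : Fin 3 → Subgroup Q := ![A₀, Am, A₁]
  let gen : Fin 3 → ℕ := ![g₀, g₁ - g₀, g - g₁]
  let cE : Fin r → Fin 3 := fun j => if s₂ ≤ (j : ℕ) then 0 else if s₁ ≤ (j : ℕ) then 1 else 2
  let T : PSCDatum Q :=
    { Sigma := Sigma
      sigma_prime := hprime
      sigma_nonempty := hne
      graph :=
        { V := Fin 3, N := Bool, C := Fin r, nodeEnds := fun b => bif b then s(1, 2) else s(0, 1)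
          cuspEnd := cE }
      vertGp := vG
      nodeGp := fun b => bif b then NB else NA
      cuspGp := fun j => ((PuncturedSurfaceGroup.cuspInertia (g := g) j).map ι).topologicalClosure
      genus := gen
      isClosed_vertGp := fun v => by
        fin_cases v <;> exact Subgroup.isClosed_topologicalClosure _
      isClosed_nodeGp := fun b => by cases b <;> exact Subgroup.isClosed_topologicalClosure _
      isClosed_cuspGp := fun _ => Subgroup.isClosed_topologicalClosure _
      nodeGp_le := fun b => by
        cases b
        · exact ⟨0, 1, rfl, ⟨1, by rw [one_smul]; exact hNA₀⟩, ⟨1, by rw [one_smul]; exact hNAm⟩⟩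
        · exact ⟨1, 2, rfl, ⟨1, by rw [one_smul]; exact hNBm⟩, ⟨1, by rw [one_smul]; exact hNB₁⟩⟩
      cuspGp_le := fun j => ⟨1, by
        rw [one_smul]
        change ((PuncturedSurfaceGroup.cuspInertia (g := g) j).map ι).topologicalClosure ≤ vG (cE j)
        by_cases h2 : s₂ ≤ (j : ℕ)
        · have : cE j = 0 := if_pos h2
          rw [this]
          exact hle _ T₀ (Subgroup.subset_closure (Or.inr ⟨j, h2, rfl⟩))
        · by_cases h1 : s₁ ≤ (j : ℕ)
          · have : cE j = 1 := by simp only [cE, if_neg h2, if_pos h1]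
            rw [this]
            exact hle _ Tm (Subgroup.subset_closure (Or.inr (Or.inl ⟨j, ⟨h1, not_le.mp h2⟩, rfl⟩)))
          · have : cE j = 2 := by simp only [cE, if_neg h2, if_neg h1]
            rw [this]
            exact hle _ T₁ (Subgroup.subset_closure (Or.inr (Or.inl ⟨j, not_le.mp h1, rfl⟩)))⟩
      proSigma := isProSigma_of_isProSigmaCompletion hι }
  refine ⟨Q, ι, T, Equiv.refl _, (0 : Fin 3), (1 : Fin 3), (2 : Fin 3), false, true, εA, η, hι, rfl, rfl,
    rfl, Fintype.card_fin r, fun _ => rfl, fun w => ?_, fun n => ?_, rfl, rfl, rfl, rfl, rfl, rfl, rfl,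
    rfl, rfl, rfl, rfl, rfl⟩
  · change (w : Fin 3) = 0 ∨ w = 1 ∨ w = 2
    fin_cases w
    · exact Or.inl rfl
    · exact Or.inr (Or.inl rfl)
    · exact Or.inr (Or.inr rfl)
  · cases n
    · exact Or.inl rfl
    · exact Or.inr rfl

/-! ### The rows at an origin of three-component chain data -/

/-- **[CombGC] Prop. 1.2 (i)(ii), Prop. 1.5 (i)(ii), [IUTchI] Rmk. 1.2.3 (iv) and [CombGC] Thm. 1.6 (i) at
every origin of three-component chain data** (`hΩ`: every datum of `Ω`-type is of chain shape, `nodeEnds`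
recorded): (1) **F-0440**; (2) datum-wise, the verticial and edge-like clauses of F-0459, the first clause of
F-0438 and the branch links; (3) **F-1931** (cuspidal characterization); (4) if every datum has a component
of genus `< 2`: **F-0459**, **F-0438**, **F-0443**, F-0461 (vacuous), and (5) for `Σ = {l}` also **F-0458**.
[cite: MochizukiCombGC2007, Prop 1.5(ii) p.13] [cite: MochizukiCombGC2007, Prop 1.5(i) p.12]
[cite: MochizukiCombGC2007, Thm 1.6(i) p.13] -/
theorem threeChainOrigin_rows (Ω : PSCOrigin.{u})
    (hΩ : ∀ ⦃Q : Type u⦄ [Group Q] [TopologicalSpace Q] (G : PSCDatum Q),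
      Ω.IsOfPSCType G → ∃ (_ : IsTopologicalGroup Q), CompactSpace Q ∧ T2Space Q ∧
        TotallyDisconnectedSpace Q ∧
        ∃ (S : Set ℕ) (g r g₀ g₁ s₁ s₂ : ℕ) (ι : PuncturedSurfaceGroup g r →* Q) (e : G.graph.C ≃ Fin r)
          (v₀ vm v₁ : G.graph.V) (nA nB : G.graph.N) (εA η : PuncturedSurfaceGroup g r),
          S.Nonempty ∧ (∀ p ∈ S, p.Prime) ∧ IsProSigmaCompletion S ι ∧ g₀ ≤ g₁ ∧ 2 ≤ s₁ ∧ s₁ + 2 ≤ s₂ ∧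
          s₂ + 2 ≤ r ∧
          (∀ c, G.cuspGp c =
            ((PuncturedSurfaceGroup.cuspInertia (g := g) (e c)).map ι).topologicalClosure) ∧
          (∀ w, w = v₀ ∨ w = vm ∨ w = v₁) ∧ (∀ n, n = nA ∨ n = nB) ∧
          εA = ((List.finRange r).map fun j : Fin r =>
              if s₂ ≤ (j : ℕ) then PuncturedSurfaceGroup.c (g := g) j else 1).prod *
            ((List.finRange g).map fun i : Fin g => if (i : ℕ) < g₀ then
              PuncturedSurfaceGroup.a (r := r) i * PuncturedSurfaceGroup.b i *
                (PuncturedSurfaceGroup.a i)⁻¹ * (PuncturedSurfaceGroup.b i)⁻¹ else 1).prod ∧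
          η = ((List.finRange r).map fun j : Fin r =>
              if s₁ ≤ (j : ℕ) then PuncturedSurfaceGroup.c (g := g) j else 1).prod *
            ((List.finRange g).map fun i : Fin g => if (i : ℕ) < g₁ then
              PuncturedSurfaceGroup.a (r := r) i * PuncturedSurfaceGroup.b i *
                (PuncturedSurfaceGroup.a i)⁻¹ * (PuncturedSurfaceGroup.b i)⁻¹ else 1).prod ∧
          G.vertGp v₀ = ((Subgroup.closure {x : PuncturedSurfaceGroup g r |
            (∃ i : Fin g, (i : ℕ) < g₀ ∧ (x = PuncturedSurfaceGroup.a i ∨ x = PuncturedSurfaceGroup.b i)) ∨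
            ∃ j : Fin r, s₂ ≤ (j : ℕ) ∧ x = PuncturedSurfaceGroup.c j}).map ι).topologicalClosure ∧
          G.vertGp vm = ((Subgroup.closure {x : PuncturedSurfaceGroup g r |
            (∃ i : Fin g, (g₀ ≤ (i : ℕ) ∧ (i : ℕ) < g₁) ∧
              (x = PuncturedSurfaceGroup.a i ∨ x = PuncturedSurfaceGroup.b i)) ∨
            (∃ j : Fin r, (s₁ ≤ (j : ℕ) ∧ (j : ℕ) < s₂) ∧ x = PuncturedSurfaceGroup.c j) ∨
            x = εA ∨ x = η}).map ι).topologicalClosure ∧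
          G.vertGp v₁ = ((Subgroup.closure {x : PuncturedSurfaceGroup g r |
            (∃ i : Fin g, g₁ ≤ (i : ℕ) ∧ (x = PuncturedSurfaceGroup.a i ∨ x = PuncturedSurfaceGroup.b i)) ∨
            (∃ j : Fin r, (j : ℕ) < s₁ ∧ x = PuncturedSurfaceGroup.c j) ∨ x = η}).map ι).topologicalClosure ∧
          G.nodeGp nA = ((Subgroup.zpowers εA).map ι).topologicalClosure ∧
          G.nodeGp nB = ((Subgroup.zpowers η).map ι).topologicalClosure ∧
          G.graph.nodeEnds nA = s(v₀, vm) ∧ G.graph.nodeEnds nB = s(vm, v₁)) :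
    EdgeLikeIncidenceHolds Ω ∧
    (∀ ⦃Q : Type u⦄ [Group Q] [TopologicalSpace Q] [IsTopologicalGroup Q] (G : PSCDatum Q),
      Ω.IsOfPSCType G → G.VerticialOpenInterDeterminesVertex ∧ G.EdgeLikeOpenInterDeterminesEdge ∧
        G.VerticialEdgeLikeCommensurablyTerminal) ∧
    CuspidalEdgeLikeCharacterizationHolds Ω ∧
    ((∀ ⦃Q : Type u⦄ [Group Q] [TopologicalSpace Q] (G : PSCDatum Q),
        Ω.IsOfPSCType G → ∃ v, G.genus v < 2) →
      OpenInterDeterminesComponentHolds Ω ∧ CommensurableTerminalityHolds Ω ∧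
        GraphicIffEdgeLikeVerticialHolds Ω ∧ UnrVerticialIffHolds Ω ∧
        ∀ l : ℕ, (∀ ⦃Q : Type u⦄ [Group Q] [TopologicalSpace Q] [IsTopologicalGroup Q] (G : PSCDatum Q),
          Ω.IsOfPSCType G → G.Sigma = {l}) → NumericallyCuspidalIffHolds Ω) := by
  -- the datum-level rows at every datum of `Ω`-type
  have hrows : ∀ ⦃Q : Type u⦄ [Group Q] [TopologicalSpace Q] (G : PSCDatum Q), Ω.IsOfPSCType G →
      ∃ (_ : IsTopologicalGroup Q), G.VerticialEdgeLikeCommensurablyTerminal ∧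
        G.VerticialOpenInterDeterminesVertex ∧ G.EdgeLikeOpenInterDeterminesEdge ∧ G.EdgeLikeIncidence ∧
        (∀ n : G.graph.N, ∃ (w₁ w₂ : G.graph.V) (γ₁ γ₂ : ConjAct Q),
          G.graph.nodeEnds n = s(w₁, w₂) ∧ γ₁ • G.nodeGp n ≤ G.vertGp w₁ ∧
            γ₂ • G.nodeGp n ≤ G.vertGp w₂ ∧ γ₁⁻¹ • G.vertGp w₁ ≠ γ₂⁻¹ • G.vertGp w₂) := by
    intro Q _ _ G hG
    obtain ⟨hTG, hc, ht, hd, S, g, r, g₀, g₁, s₁, s₂, ι, e, v₀, vm, v₁, nA, nB, εA, η, hne, hprime, hι, hg,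
      hs₁, hs₁₂, hs₂, hC, hV, hN, hεA, hη, hV₀, hVm, hV₁, hEA, hEB, hendsA, hendsB⟩ := hΩ G hG
    exact ⟨hTG, G.threeChain_rows hne hprime ι hι hg hs₁ hs₁₂ hs₂ e hC v₀ vm v₁ hV εA η hεA hη hV₀ hVm hV₁
      nA nB hN hEA hEB hendsA hendsB⟩
  have h15i : EdgeLikeIncidenceHolds Ω := fun Q _ _ G hG => by
    obtain ⟨_, -, -, -, h, -⟩ := hrows G hG
    exact h
  have hchar : CuspidalEdgeLikeCharacterizationHolds Ω :=
    cuspidalEdgeLikeCharacterizationHolds_of_cuspidallyStandard Ω fun Q _ _ _ G hG => by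
      obtain ⟨_, hc, ht, hd, S, g, r, g₀, g₁, s₁, s₂, ι, e, v₀, vm, v₁, nA, nB, εA, η, hne, hprime, hι, -,
        hs₁, hs₁₂, hs₂, hC, -⟩ := hΩ G hG
      exact ⟨hc, ht, hd, S, g, r, ι, e, hne, hprime,
        by unfold PuncturedSurfaceGroup.IsHyperbolicType; omega, hι, hC⟩
  refine ⟨h15i, fun Q _ _ _ G hG => ?_, hchar, fun hlt => ?_⟩
  · obtain ⟨_, h1, h2, h3, -, -⟩ := hrows G hG
    exact ⟨h2, h3, h1⟩
  · have h12i : OpenInterDeterminesComponentHolds Ω := fun Q _ _ _ G hG => by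
      obtain ⟨_, -, h2, h3, -, -⟩ := hrows G hG
      obtain ⟨v, hv⟩ := hlt G hG
      exact ⟨h2, h3, G.unrVerticialOpenInterDeterminesVertex_of_genus_lt_two v hv⟩
    refine ⟨h12i, fun Q _ _ _ G hG => ?_,
      graphicIffEdgeLikeVerticialHolds_of_incidence Ω h12i h15i (fun Q _ _ _ G hG => ?_),
      unrVerticialIffHolds_of_genus_lt_two Ω hlt, fun l hSig => ?_⟩
    · obtain ⟨_, h1, -⟩ := hrows G hG
      obtain ⟨v, hv⟩ := hlt G hG
      exact ⟨h1, G.unrVerticialCommensurablyTerminal_of_genus_lt_two v hv⟩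
    · obtain ⟨_, -, -, -, -, hbr⟩ := hrows G hG
      exact hbr
    · exact numericallyCuspidalIffHolds_of_characterization Ω l
        (fun Q _ _ _ G hG => by
          obtain ⟨_, hc, -, hd, -⟩ := hΩ G hG
          exact ⟨hc, hd⟩) hSig h12i hchar

/-! ### The origin with `Σ = {l}` and a rational first component: inhabited, all rows hold -/

/-- **At the origin of three-component chain data with `Σ = {l}` and a component of genus `< 2` —
inhabited, for every `g₁ ≤ g`, `2 ≤ s₁`, `s₁ + 2 ≤ s₂`, `s₂ + 2 ≤ r`, by the genuine datum with a RATIONAL first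
component (`g₀ = 0`) over a pro-`l` completion of `Γ_{g,r}` — ALL of F-0438 ([CombGC] Prop. 1.2 (ii)),
F-0459 (Prop. 1.2 (i)), F-0440 (Prop. 1.5 (i)), F-0443 (Prop. 1.5 (ii)), F-1931 ([IUTchI] Rmk. 1.2.3 (iv),
cuspidal) and F-0458 (Thm. 1.6 (i)) HOLD (and F-0461, Thm. 1.6 (iii), vacuously).**  The first genuine
carrier with TWO nodes at which these rows are settled in the kernel.
[cite: MochizukiCombGC2007, Prop 1.5(ii) p.13] [cite: MochizukiCombGC2007, Prop 1.5(i) p.12]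
[cite: MochizukiCombGC2007, Thm 1.6(i) p.13] -/
theorem exists_threeChainOrigin_holds (l : ℕ) (hl : l.Prime) :
    ∃ Ω : PSCOrigin.{0},
      (∀ g r g₁ s₁ s₂ : ℕ, g₁ ≤ g → 2 ≤ s₁ → s₁ + 2 ≤ s₂ → s₂ + 2 ≤ r →
        ∃ (Q : ProfiniteGrp.{0}) (ι : PuncturedSurfaceGroup g r →* Q) (G : PSCDatum Q),
          IsProSigmaCompletion {l} ι ∧ Ω.IsOfPSCType G ∧ G.Sigma = {l} ∧ G.graph.i = 3 ∧ G.graph.n = 2 ∧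
            G.graph.r = r) ∧
      CommensurableTerminalityHolds Ω ∧ OpenInterDeterminesComponentHolds Ω ∧ EdgeLikeIncidenceHolds Ω ∧
      GraphicIffEdgeLikeVerticialHolds Ω ∧ CuspidalEdgeLikeCharacterizationHolds Ω ∧
      NumericallyCuspidalIffHolds Ω ∧ UnrVerticialIffHolds Ω := by
  classical
  let Ω : PSCOrigin.{0} :=
    ⟨fun {Q} _ _ G => G.Sigma = {l} ∧ (∃ v, G.genus v < 2) ∧ ∃ (_ : IsTopologicalGroup Q),
      CompactSpace Q ∧ T2Space Q ∧ TotallyDisconnectedSpace Q ∧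
      ∃ (S : Set ℕ) (g r g₀ g₁ s₁ s₂ : ℕ) (ι : PuncturedSurfaceGroup g r →* Q) (e : G.graph.C ≃ Fin r)
        (v₀ vm v₁ : G.graph.V) (nA nB : G.graph.N) (εA η : PuncturedSurfaceGroup g r),
        S.Nonempty ∧ (∀ p ∈ S, p.Prime) ∧ IsProSigmaCompletion S ι ∧ g₀ ≤ g₁ ∧ 2 ≤ s₁ ∧ s₁ + 2 ≤ s₂ ∧
        s₂ + 2 ≤ r ∧
        (∀ c, G.cuspGp c =
          ((PuncturedSurfaceGroup.cuspInertia (g := g) (e c)).map ι).topologicalClosure) ∧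
        (∀ w, w = v₀ ∨ w = vm ∨ w = v₁) ∧ (∀ n, n = nA ∨ n = nB) ∧
        εA = ((List.finRange r).map fun j : Fin r =>
            if s₂ ≤ (j : ℕ) then PuncturedSurfaceGroup.c (g := g) j else 1).prod *
          ((List.finRange g).map fun i : Fin g => if (i : ℕ) < g₀ then
            PuncturedSurfaceGroup.a (r := r) i * PuncturedSurfaceGroup.b i *
              (PuncturedSurfaceGroup.a i)⁻¹ * (PuncturedSurfaceGroup.b i)⁻¹ else 1).prod ∧
        η = ((List.finRange r).map fun j : Fin r =>
            if s₁ ≤ (j : ℕ) then PuncturedSurfaceGroup.c (g := g) j else 1).prod *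
          ((List.finRange g).map fun i : Fin g => if (i : ℕ) < g₁ then
            PuncturedSurfaceGroup.a (r := r) i * PuncturedSurfaceGroup.b i *
              (PuncturedSurfaceGroup.a i)⁻¹ * (PuncturedSurfaceGroup.b i)⁻¹ else 1).prod ∧
        G.vertGp v₀ = ((Subgroup.closure {x : PuncturedSurfaceGroup g r |
          (∃ i : Fin g, (i : ℕ) < g₀ ∧ (x = PuncturedSurfaceGroup.a i ∨ x = PuncturedSurfaceGroup.b i)) ∨
          ∃ j : Fin r, s₂ ≤ (j : ℕ) ∧ x = PuncturedSurfaceGroup.c j}).map ι).topologicalClosure ∧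
        G.vertGp vm = ((Subgroup.closure {x : PuncturedSurfaceGroup g r |
          (∃ i : Fin g, (g₀ ≤ (i : ℕ) ∧ (i : ℕ) < g₁) ∧
            (x = PuncturedSurfaceGroup.a i ∨ x = PuncturedSurfaceGroup.b i)) ∨
          (∃ j : Fin r, (s₁ ≤ (j : ℕ) ∧ (j : ℕ) < s₂) ∧ x = PuncturedSurfaceGroup.c j) ∨
          x = εA ∨ x = η}).map ι).topologicalClosure ∧
        G.vertGp v₁ = ((Subgroup.closure {x : PuncturedSurfaceGroup g r |
          (∃ i : Fin g, g₁ ≤ (i : ℕ) ∧ (x = PuncturedSurfaceGroup.a i ∨ x = PuncturedSurfaceGroup.b i)) ∨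
          (∃ j : Fin r, (j : ℕ) < s₁ ∧ x = PuncturedSurfaceGroup.c j) ∨ x = η}).map ι).topologicalClosure ∧
        G.nodeGp nA = ((Subgroup.zpowers εA).map ι).topologicalClosure ∧
        G.nodeGp nB = ((Subgroup.zpowers η).map ι).topologicalClosure ∧
        G.graph.nodeEnds nA = s(v₀, vm) ∧ G.graph.nodeEnds nB = s(vm, v₁)⟩
  have hl' : ∀ p ∈ ({l} : Set ℕ), p.Prime := fun p hp => by
    rw [Set.mem_singleton_iff.mp hp]; exact hl
  obtain ⟨h15i, -, hchar, hrest⟩ := threeChainOrigin_rows Ω (fun Q _ _ G hG => hG.2.2)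
  obtain ⟨h12i, h12ii, h15ii, h16iii, h16i⟩ := hrest (fun Q _ _ G hG => hG.2.1)
  refine ⟨Ω, fun g r g₁ s₁ s₂ hg₁ hs₁ hs₁₂ hs₂ => ?_, h12ii, h12i, h15i, h15ii, hchar,
    h16i l (fun Q _ _ _ G hG => hG.1), h16iii⟩
  obtain ⟨Q, ι, G, e, v₀, vm, v₁, nA, nB, εA, η, hι, hS, hi, hn, hr, hC, hV, hN, hεA, hη, hV₀, hVm, hV₁,
    hEA, hEB, hgen₀, -, -, hendsA, hendsB⟩ :=
    exists_threeChainDatum {l} ⟨l, rfl⟩ hl' g r 0 g₁ s₁ s₂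
  exact ⟨Q, ι, G, hι, ⟨hS, ⟨v₀, by rw [hgen₀]; omega⟩, inferInstance, inferInstance, inferInstance,
    inferInstance, {l}, g, r, 0, g₁, s₁, s₂, ι, e, v₀, vm, v₁, nA, nB, εA, η, ⟨l, rfl⟩, hl', hι,
    Nat.zero_le _, hs₁, hs₁₂, hs₂, hC, hV, hN, hεA, hη, hV₀, hVm, hV₁, hEA, hEB, hendsA, hendsB⟩, hS, hi,
    hn, hr⟩

end PSCDatum

end Literature.AnabelianGeometry.SemiGraphs

end
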